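import Summits.QuantumAdvantage.QuantumAdvantage.Theorems.MobiusLadderLiouvilleNotPPolyStubMultAtShiftLemmas
import Literature.NumberTheory.EllipticCurves.PAdicBSDSplitMultiplicativeProofs
import Literature.NumberTheory.EllipticCurves.SzpiroLocalDataProofs
import Literature.NumberTheory.DiophantineGeometry.LocalReductionHasMultiplicativeReductionAtProofs
import Literature.NumberTheory.DiophantineGeometry.LocalReductionFiniteBadPlacesProofs
import HarnessLib

/-!
# Crux `MobiusLadder.LiouvilleNotPPoly` (stmt-QuantumAdvantage-1389) — stub `stub_multAtShift`

Line `SketchIdeator2` (idea `selmer-parity-transfer`), stub C2 (LEAD), registered signature: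
at every finite place `v` of `ℚ` over a prime `p ∣ 27 t − 1` (`t ≥ 1`) the curve
`E_t : y² + x·y + t·y = x³` has MULTIPLICATIVE reduction, SPLIT iff `p ≡ 1 (mod 3)`.
Multiplicativity is Silverman's criterion on the given integral equation
(`hasMultiplicativeReductionAt_of_valuation_c₄_eq_one`: `v(c₄) = 0` as `9 c₄ + 8 (27t − 1) = 1`,
`v(Δ) > 0` as `27 t − 1 ∣ Δ = t³ (1 − 27 t)`); split-ness is the `p`-adic computation of the
lemmas file (`hasSplitMultiplicativeReductionAtPrime_hesse_iff`) transported along `ℚ_v ≃ ℚ_p`,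
`O_v ≃ ℤ_p` by `hasSplitMultiplicativeReductionAtPrime_iff_hasSplitMultiplicativeReductionAt`.
-/

set_option linter.dupNamespace false -- D-0017: single-problem summit ⇒ `QuantumAdvantage.QuantumAdvantage` by design

noncomputable section

open scoped Classical

namespace Summit.QuantumAdvantage.QuantumAdvantage.Theorems.LiouvilleNotPPoly

open IsDedekindDomain IsLocalRing Polynomial WeierstrassCurve Rat.HeightOneSpectrum

/-! ### The registered stub: place-indexed statement over `ℤ` -/

section Registered

/-- `E_t / ℚ` is an elliptic curve for `t ≥ 1` (`Δ = t³ (1 − 27 t) ≠ 0`). -/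
theorem isElliptic_hesse {t : ℕ} (ht : 1 ≤ t) :
    (WeierstrassCurve.mk 1 0 (t : ℚ) 0 0).IsElliptic := by
  refine ⟨isUnit_iff_ne_zero.mpr ?_⟩
  rw [hesse_Δ]
  have h1 : (t : ℚ) ≠ 0 := by exact_mod_cast (show t ≠ 0 by omega)
  have h2 : (1 - 27 * (t : ℚ)) ≠ 0 := by
    have : ((1 - 27 * t : ℤ) : ℚ) ≠ 0 := by exact_mod_cast (show (1 - 27 * (t : ℤ)) ≠ 0 by omega)
    simpa using this
  exact mul_ne_zero (pow_ne_zero _ h1) h2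

/-- `E_t / ℚ` is `v`-integral at every finite place (integer coefficients). -/
theorem isIntegralAt_hesse (t : ℕ) (v : HeightOneSpectrum ℤ) :
    (WeierstrassCurve.mk 1 0 (t : ℚ) 0 0).IsIntegralAt v := by
  refine (WeierstrassCurve.mk 1 0 (t : ℚ) 0 0).isIntegralAt_of_valuation_le_one v ?_ ?_ ?_ ?_ ?_
  · simp
  · simp
  · change v.valuation ℚ (t : ℚ) ≤ 1
    have := HeightOneSpectrum.valuation_le_one (K := ℚ) v (t : ℤ)
    simpa using this
  · simp
  · simp

/-- From `p ∣ 27 t − 1` in `ℕ` (`t ≥ 1`) to the integer divisibility `(p : ℤ) ∣ 27 t − 1`. -/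
theorem intCast_dvd_shift {p t : ℕ} (ht : 1 ≤ t) (h : p ∣ 27 * t - 1) :
    (p : ℤ) ∣ 27 * (t : ℤ) - 1 := by
  have h' : (p : ℤ) ∣ ((27 * t - 1 : ℕ) : ℤ) := Int.natCast_dvd_natCast.mpr h
  have e : ((27 * t - 1 : ℕ) : ℤ) = 27 * (t : ℤ) - 1 := by
    have : 1 ≤ 27 * t := by omega
    push_cast [Nat.cast_sub this]
    ring
  rwa [e] at h'

/-- **`E_t / ℚ` has multiplicative reduction at every finite place over a prime `p ∣ 27 t − 1`**
(Silverman's criterion on the given integral equation: `v(c₄) = 0` since `9 c₄ + 8 (27t − 1) = 1`,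
`v(Δ) > 0` since `27 t − 1 ∣ Δ`). -/
theorem hasMultiplicativeReductionAt_hesse_of_dvd_shift {t : ℕ} (ht : 1 ≤ t)
    (v : HeightOneSpectrum ℤ) (h : natGenerator v ∣ 27 * t - 1) :
    (WeierstrassCurve.mk 1 0 (t : ℚ) 0 0).HasMultiplicativeReductionAt v := by
  haveI := isElliptic_hesse ht
  have hpt := intCast_dvd_shift ht h
  have hp := prime_natGenerator v
  refine hasMultiplicativeReductionAt_of_valuation_c₄_eq_one (isIntegralAt_hesse t v) ?_ ?_
  · rw [hesse_c₄, show (1 - 24 * (t : ℚ)) = ((1 - 24 * (t : ℤ) : ℤ) : ℚ) by push_cast; ring,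
      Literature.NumberTheory.EllipticCurves.Rat.valuation_intCast_eq_one_iff]
    intro hc
    have h1 : (natGenerator v : ℤ) ∣ 1 := by
      have := dvd_add (dvd_mul_of_dvd_right hc 9) (dvd_mul_of_dvd_right hpt 8)
      have e : (9 : ℤ) * (1 - 24 * (t : ℤ)) + 8 * (27 * (t : ℤ) - 1) = 1 := by ring
      rwa [e] at this
    have : natGenerator v = 1 := by exact_mod_cast Int.eq_one_of_dvd_one (by positivity) h1
    exact hp.one_lt.ne' this
  · rw [hesse_Δ, show (t : ℚ) ^ 3 * (1 - 27 * (t : ℚ)) = (((t : ℤ) ^ 3 * (1 - 27 * (t : ℤ)) : ℤ) : ℚ)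
      by push_cast; ring, Literature.NumberTheory.EllipticCurves.Rat.valuation_intCast_lt_one_iff]
    have : (natGenerator v : ℤ) ∣ 1 - 27 * (t : ℤ) := by
      rw [show (1 - 27 * (t : ℤ)) = -(27 * (t : ℤ) - 1) by ring]
      exact hpt.neg_right
    exact this.mul_left _

/-- **`E_t / ℚ` has split multiplicative reduction at a finite place over `p ∣ 27 t − 1` iff
`p ≡ 1 (mod 3)`** (place-indexed; transport of `hasSplitMultiplicativeReductionAtPrime_hesse_iff`
along `ℚ_v ≃ ℚ_p`, `O_v ≃ ℤ_p`). -/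
theorem hasSplitMultiplicativeReductionAt_hesse_iff_of_dvd_shift {t : ℕ} (ht : 1 ≤ t)
    (v : HeightOneSpectrum ℤ) (h : natGenerator v ∣ 27 * t - 1) :
    (WeierstrassCurve.mk 1 0 (t : ℚ) 0 0).HasSplitMultiplicativeReductionAt v ↔
      natGenerator v % 3 = 1 := by
  haveI := isElliptic_hesse ht
  haveI : Fact (natGenerator v).Prime := ⟨prime_natGenerator v⟩
  have hpt := intCast_dvd_shift ht h
  have key := hasSplitMultiplicativeReductionAtPrime_iff_hasSplitMultiplicativeReductionAt
    (WeierstrassCurve.mk 1 0 (t : ℚ) 0 0) v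
  change (WeierstrassCurve.mk 1 0 (t : ℚ) 0 0).HasSplitMultiplicativeReductionAtPrime (natGenerator v) ↔
    _ at key
  rw [← key]
  have := hasSplitMultiplicativeReductionAtPrime_hesse_iff (p := natGenerator v) (t := (t : ℤ))
    (by exact_mod_cast ht) hpt
  simpa using this

/-- **STUB C2 · `stub_multAtShift`** (registered signature of the line `SketchIdeator2` for the
crux `MobiusLadder.LiouvilleNotPPoly`, stmt-QuantumAdvantage-1389): at every finite place over a
prime `p ∣ 27 t − 1` (`t ≥ 1`) the curve `E_t : y² + x·y + t·y = x³` has multiplicative reduction,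
split iff `p ≡ 1 (mod 3)`. Hence its local root number there is `−1` iff `p ≡ 1 (mod 3)`
(Rohrlich 1993, Prop. 2(ii)), which is where `ω₁(27 t − 1)` enters the root-number formula
`w(E_t) = −(−1)^{ω(t)} (−1)^{ω₁(27t−1)}`. -/
theorem stub_multAtShift :
    ∀ t : ℕ, 1 ≤ t → ∀ v : HeightOneSpectrum ℤ, Rat.HeightOneSpectrum.natGenerator v ∣ 27 * t - 1 →
    ({ a₁ := 1, a₂ := 0, a₃ := (t : ℚ), a₄ := 0, a₆ := 0 } : WeierstrassCurve ℚ).HasMultiplicativeReductionAt v ∧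
    (({ a₁ := 1, a₂ := 0, a₃ := (t : ℚ), a₄ := 0, a₆ := 0 } : WeierstrassCurve ℚ).HasSplitMultiplicativeReductionAt v ↔
      Rat.HeightOneSpectrum.natGenerator v % 3 = 1) :=
  fun _ ht v h =>
    ⟨hasMultiplicativeReductionAt_hesse_of_dvd_shift ht v h,
      hasSplitMultiplicativeReductionAt_hesse_iff_of_dvd_shift ht v h⟩

end Registered

end Summit.QuantumAdvantage.QuantumAdvantage.Theorems.LiouvilleNotPPoly

end
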